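import Summits.AtomisticToContinuum.FouriersLaw.Theorems.PhononMeanFreePathDefs

/-!
# Line `Sketch` of crux `PhononMeanFreePath.CoherentDephasing` (stmt-AtomisticToContinuum-11810): the right energy balance

Stub `stub_rightBalance_of_meanField` of the lead's skeleton of line `Sketch` (coherent-field Beer–Lambert) of the
crux `PhononMeanFreePath.CoherentDephasing`, over the route vocabulary of
`Theorems/PhononMeanFreePathDefs.lean` (section CoherentField: `momResp`, `posResp`, `cubeResp`, `stretchCubeResp`,
`bondForceResp`, `cohFlux`, `absorbedWork`). It is PURE REAL ANALYSIS at fixed `N`: writing `m_x, n_x, c_x` for the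
momentum / position / cubic responses of site `x : Fin (N+1)` and `d_b, F_b` for the cubic-stretch / full-force
responses of bond `b = (b.castSucc, b.succ)`, the hypotheses are

* the Duhamel (integrated Dynkin) equations for `t ≥ 0`: `n_x(t) = ∫₀ᵗ m_x`,
  `m_x(t) = T[x=0] + ∫₀ᵗ φ_x`, `φ_x = -ω₂ n_x - lam c_x + Σ_{b'}([b'=x] - [b'+1=x]) F_{b'} - γ([x=0]+[x=N]) m_x`;
* continuity of `m, n, c, d`, the split `F_b = (n_{b+1} - n_b) + β d_b`, and `|m|,|n|,|c|,|d| ≤ C e^{-rt}` (`r > 0`)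
  on `t ≥ 0`,

and the conclusion is, for every bond `b`, `cohFlux b = γ ∫₀^∞ m_N² + absorbedWork b`, where
`cohFlux b = -∫₀^∞ m_{b+1} F_b` and
`absorbedWork b = lam Σ_{x ≥ b+1} ∫₀^∞ m_x c_x + β Σ_{b' > b} ∫₀^∞ d_{b'} (m_{b'+1} - m_{b'})`.

Proof (`rightBalance_of_duhamel`, stated for abstract functions; the stub is its read-back): by FTC-1 the Duhamel
equations differentiate on `(0, ∞)` (`n_x' = m_x`, `m_x' = φ_x`); the harmonic energy strictly to the right of `b`,
`E(t) = ½ Σ_{x ≥ b+1} (m_x² + ω₂ n_x²) + ½ Σ_{b' > b} (n_{b'+1} - n_{b'})²`, has derivative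
`-(lam Σ m_x c_x + β Σ d_{b'}(m_{b'+1} - m_{b'}) + γ m_N² + m_{b+1} F_b)` — the bookkeeping identity
`energy_balance_algebra` (pure `Finset` algebra: the bond forces telescope, the bath indicator only sees `x = N`
because `x ≥ b+1 ≥ 1`); `E(0) = 0` (`n(0) = 0`, `m_x(0) = 0` for `x ≥ 1`), `E(∞) = 0` (decay), and every product is
integrable on `(0, ∞)` (continuous, `≤ K e^{-rt}`), so `∫₀^∞ (-E') = E(0) - E(∞) = 0`
(`MeasureTheory.integral_Ioi_of_hasDerivAt_of_tendsto`), which is the balance after splitting the integral.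
-/

noncomputable section

open MeasureTheory Set Filter Topology

namespace Summit.AtomisticToContinuum.FouriersLaw.Theorems.CoherentDephasing.RightBalance

open Literature.MathematicalPhysics.KineticTheory.HeatConduction
open Summit.AtomisticToContinuum.FouriersLaw.Theorems.PhononMeanFreePath

/-! ### Exponentially bounded continuous functions on `[0, ∞)` -/

/-- A product of two functions bounded by `Kᵢ e^{-rt}` (`r > 0`, `t ≥ 0`) is bounded by `K₁ K₂ e^{-rt}`.
[folklore] -/
theorem abs_mul_le_of_abs_le_exp {u v K₁ K₂ r t : ℝ} (hr : 0 < r) (ht : 0 ≤ t)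
    (hu : |u| ≤ K₁ * Real.exp (-r * t)) (hv : |v| ≤ K₂ * Real.exp (-r * t)) :
    |u * v| ≤ K₁ * K₂ * Real.exp (-r * t) := by
  have he : Real.exp (-r * t) ≤ 1 :=
    Real.exp_le_one_iff.mpr (by rw [neg_mul, neg_nonpos]; exact mul_nonneg hr.le ht)
  have hK₁ : 0 ≤ K₁ * Real.exp (-r * t) := (abs_nonneg u).trans hu
  have hK₂ : 0 ≤ K₂ :=
    le_of_mul_le_mul_right (by rw [zero_mul]; exact (abs_nonneg v).trans hv) (Real.exp_pos _)
  rw [abs_mul]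
  calc |u| * |v| ≤ K₁ * Real.exp (-r * t) * (K₂ * Real.exp (-r * t)) :=
        mul_le_mul hu hv (abs_nonneg v) hK₁
    _ ≤ K₁ * Real.exp (-r * t) * (K₂ * 1) :=
        mul_le_mul_of_nonneg_left (mul_le_mul_of_nonneg_left he hK₂) hK₁
    _ = K₁ * K₂ * Real.exp (-r * t) := by ring

/-- Triangle inequality for a difference of two functions with a common envelope. [folklore] -/
theorem abs_sub_le_of_abs_le {u v K₁ K₂ e : ℝ} (hu : |u| ≤ K₁ * e) (hv : |v| ≤ K₂ * e) :
    |u - v| ≤ (K₁ + K₂) * e := by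
  rw [add_mul]; exact (abs_sub u v).trans (add_le_add hu hv)

/-- Triangle inequality for a sum of two functions with a common envelope. [folklore] -/
theorem abs_add_le_of_abs_le {u v K₁ K₂ e : ℝ} (hu : |u| ≤ K₁ * e) (hv : |v| ≤ K₂ * e) :
    |u + v| ≤ (K₁ + K₂) * e := by
  rw [add_mul]; exact (abs_add_le u v).trans (add_le_add hu hv)

/-- A continuous function with `|f t| ≤ K e^{-rt}` on `t ≥ 0` (`r > 0`) is integrable on `(0, ∞)`.
[folklore] -/
theorem integrableOn_Ioi_of_abs_le_exp {f : ℝ → ℝ} {K r : ℝ} (hr : 0 < r) (hf : Continuous f)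
    (h : ∀ t, 0 ≤ t → |f t| ≤ K * Real.exp (-r * t)) : IntegrableOn f (Ioi 0) := by
  refine integrable_of_isBigO_exp_neg hr hf.continuousOn (Asymptotics.IsBigO.of_bound K ?_)
  filter_upwards [eventually_ge_atTop 0] with t ht
  rw [Real.norm_eq_abs, Real.norm_eq_abs, abs_of_pos (Real.exp_pos _)]
  exact h t ht

/-- A function with `|f t| ≤ K e^{-rt}` on `t ≥ 0` (`r > 0`) tends to `0` at `+∞`. [folklore] -/
theorem tendsto_zero_of_abs_le_exp {f : ℝ → ℝ} {K r : ℝ} (hr : 0 < r)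
    (h : ∀ t, 0 ≤ t → |f t| ≤ K * Real.exp (-r * t)) : Tendsto f atTop (𝓝 0) := by
  have h1 : Tendsto (fun t => K * Real.exp (-r * t)) atTop (𝓝 (K * 0)) :=
    (Real.tendsto_exp_atBot.comp
      (tendsto_id.const_mul_atTop_of_neg (neg_neg_iff_pos.2 hr))).const_mul K
  rw [mul_zero] at h1
  refine squeeze_zero_norm' ?_ h1
  filter_upwards [eventually_ge_atTop 0] with t ht
  rw [Real.norm_eq_abs]
  exact h t ht

/-! ### The bookkeeping algebra of the harmonic energy to the right of a bond -/

/-- `Σ_{x ≥ b+1} m_x Σ_{b'} [b' = x] F_{b'} = Σ_{b' > b} m_{b'} F_{b'}` (left ends of bonds). [folklore] -/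
theorem sum_mul_sum_ite_val_eq {N : ℕ} (m : Fin (N + 1) → ℝ) (F : Fin N → ℝ) (b : Fin N) :
    ∑ x ∈ Finset.univ.filter (fun x : Fin (N + 1) => b.succ ≤ x),
        m x * ∑ b' : Fin N, (if (b' : ℕ) = (x : ℕ) then F b' else 0) =
      ∑ b' ∈ Finset.univ.filter (fun b' : Fin N => b < b'), m b'.castSucc * F b' := by
  have key : ∀ (b' : Fin N) (x : Fin (N + 1)), ((b' : ℕ) = (x : ℕ)) ↔ b'.castSucc = x :=
    fun b' x => by rw [Fin.ext_iff, Fin.val_castSucc]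
  simp_rw [key, Finset.mul_sum, mul_ite, mul_zero]
  rw [Finset.sum_comm]
  simp_rw [Finset.sum_ite_eq, Finset.mem_filter, Finset.mem_univ, true_and,
    Fin.succ_le_castSucc_iff]
  rw [Finset.sum_filter]

/-- `Σ_{x ≥ b+1} m_x Σ_{b'} [b'+1 = x] F_{b'} = m_{b+1} F_b + Σ_{b' > b} m_{b'+1} F_{b'}` (right ends of
bonds). [folklore] -/
theorem sum_mul_sum_ite_succ_eq {N : ℕ} (m : Fin (N + 1) → ℝ) (F : Fin N → ℝ) (b : Fin N) :
    ∑ x ∈ Finset.univ.filter (fun x : Fin (N + 1) => b.succ ≤ x),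
        m x * ∑ b' : Fin N, (if (b' : ℕ) + 1 = (x : ℕ) then F b' else 0) =
      m b.succ * F b +
        ∑ b' ∈ Finset.univ.filter (fun b' : Fin N => b < b'), m b'.succ * F b' := by
  have key : ∀ (b' : Fin N) (x : Fin (N + 1)), ((b' : ℕ) + 1 = (x : ℕ)) ↔ b'.succ = x :=
    fun b' x => by rw [Fin.ext_iff, Fin.val_succ]
  simp_rw [key, Finset.mul_sum, mul_ite, mul_zero]
  rw [Finset.sum_comm]
  simp_rw [Finset.sum_ite_eq, Finset.mem_filter, Finset.mem_univ, true_and, Fin.succ_le_succ_iff]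
  have split : ∀ b' : Fin N, (if b ≤ b' then m b'.succ * F b' else 0) =
      (if b = b' then m b'.succ * F b' else 0) + (if b < b' then m b'.succ * F b' else 0) := by
    intro b'
    rcases lt_trichotomy b b' with h | rfl | h
    · rw [if_pos h.le, if_neg h.ne, if_pos h, zero_add]
    · rw [if_pos le_rfl, if_pos rfl, if_neg (lt_irrefl _), add_zero]
    · rw [if_neg (not_le.mpr h), if_neg h.ne', if_neg (not_lt.mpr h.le), add_zero]
  simp_rw [split]
  rw [Finset.sum_add_distrib, Finset.sum_ite_eq, Finset.sum_filter]
  simp only [Finset.mem_univ, if_true]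

/-- On the sites `x ≥ b+1 ≥ 1` the bath indicator `[x = 0] + [x = N]` only sees the right bath:
`Σ_{x ≥ b+1} ([x=0] + [x=N]) m_x² = m_N²`. [folklore] -/
theorem sum_bath_indicator_mul_eq {N : ℕ} (m : Fin (N + 1) → ℝ) (b : Fin N) :
    ∑ x ∈ Finset.univ.filter (fun x : Fin (N + 1) => b.succ ≤ x),
        ((if (x : ℕ) = 0 then (1 : ℝ) else 0) + (if (x : ℕ) = N then (1 : ℝ) else 0)) * m x * m x =
      m (Fin.last N) ^ 2 := by
  have hlast : Fin.last N ∈ Finset.univ.filter (fun x : Fin (N + 1) => b.succ ≤ x) :=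
    Finset.mem_filter.mpr ⟨Finset.mem_univ _, Fin.le_last _⟩
  rw [← Finset.add_sum_erase _ _ hlast, Finset.sum_eq_zero, add_zero]
  · have hN : N ≠ 0 := (Fin.pos b).ne'
    simp [hN, sq]
  · intro x hx
    obtain ⟨hne, hx⟩ := Finset.mem_erase.mp hx
    have hle := (Finset.mem_filter.mp hx).2
    have h0 : (x : ℕ) ≠ 0 := by rw [Fin.le_def, Fin.val_succ] at hle; omega
    have hxN : (x : ℕ) ≠ N := fun h => hne (Fin.ext (by rw [h, Fin.val_last]))
    simp [h0, hxN]

/-- **The bookkeeping identity** (pointwise in time). With the drive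
`φ_x = -ω₂ n_x - lam c_x + Σ_{b'} ([b' = x] - [b'+1 = x]) F_{b'} - γ ([x=0] + [x=N]) m_x` and the split
`F_{b'} = (n_{b'+1} - n_{b'}) + β d_{b'}`, the time derivative of the harmonic energy strictly to the right of
bond `b`, `Σ_{x ≥ b+1} (m_x φ_x + ω₂ n_x m_x) + Σ_{b' > b} (n_{b'+1} - n_{b'})(m_{b'+1} - m_{b'})`, equals
`-(lam Σ_{x ≥ b+1} m_x c_x + β Σ_{b' > b} d_{b'} (m_{b'+1} - m_{b'}) + γ m_N² + m_{b+1} F_b)`. [folklore] -/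
theorem energy_balance_algebra {N : ℕ} (ω₂ lam β γ : ℝ) (m n c φ : Fin (N + 1) → ℝ) (d F : Fin N → ℝ)
    (b : Fin N) (hF : ∀ b' : Fin N, F b' = n b'.succ - n b'.castSucc + β * d b')
    (hφ : ∀ x : Fin (N + 1), φ x = -(ω₂ * n x) - lam * c x +
      (∑ b' : Fin N, ((if (b' : ℕ) = (x : ℕ) then F b' else 0) -
        (if (b' : ℕ) + 1 = (x : ℕ) then F b' else 0))) -
      γ * ((if (x : ℕ) = 0 then 1 else 0) + (if (x : ℕ) = N then 1 else 0)) * m x) :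
    (∑ x ∈ Finset.univ.filter (fun x : Fin (N + 1) => b.succ ≤ x), (m x * φ x + ω₂ * (n x * m x))) +
        ∑ b' ∈ Finset.univ.filter (fun b' : Fin N => b < b'),
          (n b'.succ - n b'.castSucc) * (m b'.succ - m b'.castSucc) =
      -(lam * (∑ x ∈ Finset.univ.filter (fun x : Fin (N + 1) => b.succ ≤ x), m x * c x) +
        β * (∑ b' ∈ Finset.univ.filter (fun b' : Fin N => b < b'),
          d b' * (m b'.succ - m b'.castSucc)) +
        γ * m (Fin.last N) ^ 2 + m b.succ * F b) := by
  have h1 := sum_mul_sum_ite_val_eq m F b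
  have h2 := sum_mul_sum_ite_succ_eq m F b
  have h3 := sum_bath_indicator_mul_eq m b
  have h4 : ∑ b' ∈ Finset.univ.filter (fun b' : Fin N => b < b'), m b'.castSucc * F b' -
      ∑ b' ∈ Finset.univ.filter (fun b' : Fin N => b < b'), m b'.succ * F b' +
      ∑ b' ∈ Finset.univ.filter (fun b' : Fin N => b < b'),
        (n b'.succ - n b'.castSucc) * (m b'.succ - m b'.castSucc) =
      -(β * ∑ b' ∈ Finset.univ.filter (fun b' : Fin N => b < b'),
        d b' * (m b'.succ - m b'.castSucc)) := by
    rw [← Finset.sum_sub_distrib, ← Finset.sum_add_distrib, Finset.mul_sum, ← Finset.sum_neg_distrib]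
    refine Finset.sum_congr rfl fun b' _ => ?_
    rw [hF]; ring
  have h5 : ∀ x : Fin (N + 1), m x * φ x + ω₂ * (n x * m x) =
      -(lam * (m x * c x)) + m x * (∑ b' : Fin N, if (b' : ℕ) = (x : ℕ) then F b' else 0) -
        m x * (∑ b' : Fin N, if (b' : ℕ) + 1 = (x : ℕ) then F b' else 0) -
        γ * (((if (x : ℕ) = 0 then (1 : ℝ) else 0) + (if (x : ℕ) = N then (1 : ℝ) else 0)) * m x * m x) := by
    intro x; rw [hφ, Finset.sum_sub_distrib]; ring
  rw [Finset.sum_congr rfl fun x _ => h5 x, Finset.sum_sub_distrib, Finset.sum_sub_distrib,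
    Finset.sum_add_distrib, Finset.sum_neg_distrib, ← Finset.mul_sum, ← Finset.mul_sum, h1, h2, h3]
  linear_combination h4

/-! ### The right energy balance for an abstract solution of the mean-field equations -/

/-- **Right energy balance, abstract form.** Let `m_x, n_x, c_x` (`x : Fin (N+1)`) and `d_b, F_b`
(`b : Fin N`) be continuous real functions with `|m|, |n|, |c|, |d| ≤ C e^{-rt}` on `t ≥ 0` (`r > 0`),
`F_b = (n_{b+1} - n_b) + β d_b`, solving for `t ≥ 0` the Duhamel equations `n_x(t) = ∫₀ᵗ m_x`,
`m_x(t) = T[x=0] + ∫₀ᵗ (-ω₂ n_x - lam c_x + Σ_{b'}([b'=x] - [b'+1=x]) F_{b'} - γ([x=0]+[x=N]) m_x)`. Then for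
every bond `b`: `-∫₀^∞ m_{b+1} F_b = γ ∫₀^∞ m_N² + lam Σ_{x ≥ b+1} ∫₀^∞ m_x c_x + β Σ_{b' > b} ∫₀^∞ d_{b'}(m_{b'+1} - m_{b'})`
(FTC for the harmonic energy right of `b`, which vanishes at `t = 0` and at `t = ∞`). [folklore] -/
theorem rightBalance_of_duhamel {N : ℕ} {ω₂ lam β γ T : ℝ} {m n c : Fin (N + 1) → ℝ → ℝ}
    {d F : Fin N → ℝ → ℝ}
    (hn : ∀ (x : Fin (N + 1)) (t : ℝ), 0 ≤ t → n x t = ∫ s in (0 : ℝ)..t, m x s)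
    (hm : ∀ (x : Fin (N + 1)) (t : ℝ), 0 ≤ t → m x t = (if (x : ℕ) = 0 then T else 0) +
      ∫ s in (0 : ℝ)..t, (-(ω₂ * n x s) - lam * c x s +
        (∑ b : Fin N, ((if (b : ℕ) = (x : ℕ) then F b s else 0) -
          (if (b : ℕ) + 1 = (x : ℕ) then F b s else 0))) -
        γ * ((if (x : ℕ) = 0 then 1 else 0) + (if (x : ℕ) = N then 1 else 0)) * m x s))
    (hmc : ∀ x, Continuous (m x)) (hnc : ∀ x, Continuous (n x)) (hcc : ∀ x, Continuous (c x))
    (hdc : ∀ b, Continuous (d b))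
    (hF : ∀ (b : Fin N) (t : ℝ), F b t = n b.succ t - n b.castSucc t + β * d b t)
    {C r : ℝ} (hr : 0 < r)
    (hmb : ∀ (x : Fin (N + 1)) (t : ℝ), 0 ≤ t → |m x t| ≤ C * Real.exp (-r * t))
    (hnb : ∀ (x : Fin (N + 1)) (t : ℝ), 0 ≤ t → |n x t| ≤ C * Real.exp (-r * t))
    (hcb : ∀ (x : Fin (N + 1)) (t : ℝ), 0 ≤ t → |c x t| ≤ C * Real.exp (-r * t))
    (hdb : ∀ (b : Fin N) (t : ℝ), 0 ≤ t → |d b t| ≤ C * Real.exp (-r * t))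
    (b : Fin N) :
    -∫ t in Ioi (0 : ℝ), m b.succ t * F b t =
      γ * (∫ t in Ioi (0 : ℝ), m (Fin.last N) t ^ 2) +
        (lam * (∑ x ∈ Finset.univ.filter (fun x : Fin (N + 1) => b.succ ≤ x),
            ∫ t in Ioi (0 : ℝ), m x t * c x t) +
          β * ∑ b' ∈ Finset.univ.filter (fun b' : Fin N => b < b'),
            ∫ t in Ioi (0 : ℝ), d b' t * (m b'.succ t - m b'.castSucc t)) := by
  -- the drive `φ_x` of the momentum equation
  obtain ⟨φ, hφ⟩ : ∃ φ : Fin (N + 1) → ℝ → ℝ, ∀ x s, φ x s = -(ω₂ * n x s) - lam * c x s +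
      (∑ b : Fin N, ((if (b : ℕ) = (x : ℕ) then F b s else 0) -
        (if (b : ℕ) + 1 = (x : ℕ) then F b s else 0))) -
      γ * ((if (x : ℕ) = 0 then 1 else 0) + (if (x : ℕ) = N then 1 else 0)) * m x s :=
    ⟨_, fun _ _ => rfl⟩
  -- continuity of the bond force and of the drive
  have hFc : ∀ b', Continuous (F b') := fun b' => by
    rw [show F b' = fun t => n b'.succ t - n b'.castSucc t + β * d b' t from funext (hF b')]
    fun_prop
  have hφc : ∀ x, Continuous (φ x) := fun x => by
    rw [show φ x = _ from funext (hφ x)]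
    exact ((((hnc x).const_mul ω₂).neg.sub ((hcc x).const_mul lam)).add
      (continuous_finsetSum _ fun b' _ => ((hFc b').if_const _ continuous_const).sub
        ((hFc b').if_const _ continuous_const))).sub (continuous_const.mul (hmc x))
  -- STEP 1: the Duhamel equations differentiate on `(0, ∞)`
  have hdn : ∀ (x : Fin (N + 1)) (t : ℝ), 0 < t → HasDerivAt (n x) (m x t) t := fun x t ht =>
    ((hmc x).integral_hasStrictDerivAt 0 t).hasDerivAt.congr_of_eventuallyEq
      ((lt_mem_nhds ht).mono fun u hu => hn x u hu.le)
  have hdm : ∀ (x : Fin (N + 1)) (t : ℝ), 0 < t → HasDerivAt (m x) (φ x t) t := fun x t ht => by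
    refine (((hφc x).integral_hasStrictDerivAt 0 t).hasDerivAt.const_add
      (if (x : ℕ) = 0 then T else 0)).congr_of_eventuallyEq ((lt_mem_nhds ht).mono fun u hu => ?_)
    rw [hm x u hu.le]
    simp only [hφ]
  -- STEP 2: the harmonic energy strictly to the right of `b` and its dissipation/transfer rate
  obtain ⟨E, hE⟩ : ∃ E : ℝ → ℝ, E = fun t =>
      (∑ x ∈ Finset.univ.filter (fun x : Fin (N + 1) => b.succ ≤ x),
          (m x t * m x t + ω₂ * (n x t * n x t)) / 2) +
        ∑ b' ∈ Finset.univ.filter (fun b' : Fin N => b < b'),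
          (n b'.succ t - n b'.castSucc t) * (n b'.succ t - n b'.castSucc t) / 2 := ⟨_, rfl⟩
  obtain ⟨P, hP⟩ : ∃ P : ℝ → ℝ, P = fun t =>
      lam * (∑ x ∈ Finset.univ.filter (fun x : Fin (N + 1) => b.succ ≤ x), m x t * c x t) +
        β * (∑ b' ∈ Finset.univ.filter (fun b' : Fin N => b < b'),
          d b' t * (m b'.succ t - m b'.castSucc t)) +
        γ * m (Fin.last N) t ^ 2 + m b.succ t * F b t := ⟨_, rfl⟩
  have hderiv : ∀ t, 0 < t → HasDerivAt E (-P t) t := by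
    intro t ht
    have h1 : HasDerivAt (fun t => ∑ x ∈ Finset.univ.filter (fun x : Fin (N + 1) => b.succ ≤ x),
        (m x t * m x t + ω₂ * (n x t * n x t)) / 2)
        (∑ x ∈ Finset.univ.filter (fun x : Fin (N + 1) => b.succ ≤ x),
          (m x t * φ x t + ω₂ * (n x t * m x t))) t := by
      refine HasDerivAt.fun_sum fun x _ => ?_
      refine ((((hdm x t ht).fun_mul (hdm x t ht)).fun_add
        (((hdn x t ht).fun_mul (hdn x t ht)).const_mul ω₂)).div_const 2).congr_deriv ?_
      ring
    have h2 : HasDerivAt (fun t => ∑ b' ∈ Finset.univ.filter (fun b' : Fin N => b < b'),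
        (n b'.succ t - n b'.castSucc t) * (n b'.succ t - n b'.castSucc t) / 2)
        (∑ b' ∈ Finset.univ.filter (fun b' : Fin N => b < b'),
          (n b'.succ t - n b'.castSucc t) * (m b'.succ t - m b'.castSucc t)) t := by
      refine HasDerivAt.fun_sum fun b' _ => ?_
      refine ((((hdn b'.succ t ht).fun_sub (hdn b'.castSucc t ht)).fun_mul
        ((hdn b'.succ t ht).fun_sub (hdn b'.castSucc t ht))).div_const 2).congr_deriv ?_
      ring
    rw [hE, hP]
    refine (h1.fun_add h2).congr_deriv ?_
    exact energy_balance_algebra ω₂ lam β γ (fun x => m x t) (fun x => n x t) (fun x => c x t)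
      (fun x => φ x t) (fun b' => d b' t) (fun b' => F b' t) b (fun b' => hF b' t) (fun x => hφ x t)
  -- STEP 3: `E` is continuous, vanishes at `0` and at `∞`
  have hEc : Continuous E := by
    rw [hE]
    exact (continuous_finsetSum _ fun x _ => (((hmc x).mul (hmc x)).add
      (((hnc x).mul (hnc x)).const_mul ω₂)).div_const 2).add
      (continuous_finsetSum _ fun b' _ => (((hnc _).sub (hnc _)).mul ((hnc _).sub (hnc _))).div_const 2)
  have hE0 : E 0 = 0 := by
    have hn0 : ∀ x, n x 0 = 0 := fun x => by rw [hn x 0 le_rfl, intervalIntegral.integral_same]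
    have hm0 : ∀ x ∈ Finset.univ.filter (fun x : Fin (N + 1) => b.succ ≤ x), m x 0 = 0 := by
      intro x hx
      have hle := (Finset.mem_filter.mp hx).2
      have h0 : (x : ℕ) ≠ 0 := by rw [Fin.le_def, Fin.val_succ] at hle; omega
      rw [hm x 0 le_rfl, intervalIntegral.integral_same, add_zero, if_neg h0]
    rw [hE]
    simp only
    rw [Finset.sum_eq_zero fun x hx => by rw [hm0 x hx, hn0]; ring,
      Finset.sum_eq_zero fun b' _ => by rw [hn0, hn0]; ring, add_zero]
  have hEt : Tendsto E atTop (𝓝 0) := by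
    have hm0 : ∀ x, Tendsto (m x) atTop (𝓝 0) := fun x => tendsto_zero_of_abs_le_exp hr (hmb x)
    have hn0 : ∀ x, Tendsto (n x) atTop (𝓝 0) := fun x => tendsto_zero_of_abs_le_exp hr (hnb x)
    have := (tendsto_finsetSum (Finset.univ.filter (fun x : Fin (N + 1) => b.succ ≤ x))
      fun x _ => (((hm0 x).mul (hm0 x)).add (((hn0 x).mul (hn0 x)).const_mul ω₂)).div_const 2).add
      (tendsto_finsetSum (Finset.univ.filter (fun b' : Fin N => b < b'))
        fun b' _ => (((hn0 b'.succ).sub (hn0 b'.castSucc)).mul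
          ((hn0 b'.succ).sub (hn0 b'.castSucc))).div_const 2)
    rw [hE]
    simpa using this
  -- STEP 4: every product is integrable on `(0, ∞)`
  have i1 : ∀ x, IntegrableOn (fun t => m x t * c x t) (Ioi 0) := fun x =>
    integrableOn_Ioi_of_abs_le_exp hr ((hmc x).mul (hcc x))
      fun t ht => abs_mul_le_of_abs_le_exp hr ht (hmb x t ht) (hcb x t ht)
  have i2 : ∀ b', IntegrableOn (fun t => d b' t * (m b'.succ t - m b'.castSucc t)) (Ioi 0) :=
    fun b' => integrableOn_Ioi_of_abs_le_exp hr ((hdc b').mul ((hmc _).sub (hmc _)))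
      fun t ht => abs_mul_le_of_abs_le_exp hr ht (hdb b' t ht)
        (abs_sub_le_of_abs_le (hmb _ t ht) (hmb _ t ht))
  have i3 : IntegrableOn (fun t => m (Fin.last N) t ^ 2) (Ioi 0) := by
    refine integrableOn_Ioi_of_abs_le_exp (K := C * C) hr ((hmc _).pow 2) fun t ht => ?_
    rw [sq]
    exact abs_mul_le_of_abs_le_exp hr ht (hmb _ t ht) (hmb _ t ht)
  have i4 : IntegrableOn (fun t => m b.succ t * F b t) (Ioi 0) := by
    refine integrableOn_Ioi_of_abs_le_exp (K := C * (C + C + |β| * C)) hr ((hmc _).mul (hFc b))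
      fun t ht => abs_mul_le_of_abs_le_exp hr ht (hmb _ t ht) ?_
    rw [hF]
    refine abs_add_le_of_abs_le (abs_sub_le_of_abs_le (hnb _ t ht) (hnb _ t ht)) ?_
    rw [abs_mul, mul_assoc]
    exact mul_le_mul_of_nonneg_left (hdb b t ht) (abs_nonneg β)
  have i1S : IntegrableOn (fun t => ∑ x ∈ Finset.univ.filter (fun x : Fin (N + 1) => b.succ ≤ x),
      m x t * c x t) (Ioi 0) := integrable_finsetSum _ fun x _ => i1 x
  have i2B : IntegrableOn (fun t => ∑ b' ∈ Finset.univ.filter (fun b' : Fin N => b < b'),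
      d b' t * (m b'.succ t - m b'.castSucc t)) (Ioi 0) := integrable_finsetSum _ fun b' _ => i2 b'
  have hPi : IntegrableOn P (Ioi 0) := by
    rw [hP]
    exact (((i1S.const_mul lam).fun_add (i2B.const_mul β)).fun_add (i3.const_mul γ)).fun_add i4
  -- STEP 5: `∫₀^∞ P = E(0) - E(∞) = 0`, and split the integral
  have hPint : ∫ t in Ioi (0 : ℝ), P t = 0 := by
    have h := integral_Ioi_of_hasDerivAt_of_tendsto (f := fun t => -E t) (m := 0)
      hEc.neg.continuousWithinAt
      (fun t ht => ((hderiv t ht).fun_neg).congr_deriv (neg_neg _)) hPi (by simpa using hEt.neg)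
    rw [h, hE0, neg_zero, sub_zero]
  have hPsplit : ∫ t in Ioi (0 : ℝ), P t =
      lam * (∑ x ∈ Finset.univ.filter (fun x : Fin (N + 1) => b.succ ≤ x),
          ∫ t in Ioi (0 : ℝ), m x t * c x t) +
        β * (∑ b' ∈ Finset.univ.filter (fun b' : Fin N => b < b'),
          ∫ t in Ioi (0 : ℝ), d b' t * (m b'.succ t - m b'.castSucc t)) +
        γ * (∫ t in Ioi (0 : ℝ), m (Fin.last N) t ^ 2) + ∫ t in Ioi (0 : ℝ), m b.succ t * F b t := by
    rw [hP]
    simp only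
    rw [integral_add (((i1S.const_mul lam).fun_add (i2B.const_mul β)).fun_add (i3.const_mul γ)) i4,
      integral_add ((i1S.const_mul lam).fun_add (i2B.const_mul β)) (i3.const_mul γ),
      integral_add (i1S.const_mul lam) (i2B.const_mul β), integral_const_mul, integral_const_mul,
      integral_const_mul, integral_finsetSum _ fun x _ => i1 x, integral_finsetSum _ fun b' _ => i2 b']
  rw [hPsplit] at hPint
  linarith

/-! ### The registered stub of line `Sketch` -/

/-- **Right energy balance from the mean-field equations** (stub `stub_rightBalance_of_meanField` of line `Sketch`
of crux `PhononMeanFreePath.CoherentDephasing`, fixed `N`, pure real analysis). At one admissible parameter point and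
one `N`, the Duhamel equations of the coherent response field `(n_x, m_x) = (posResp, momResp)` together with the
continuity of `momResp, posResp, cubeResp, stretchCubeResp`, the split
`bondForceResp b = (posResp b.succ - posResp b.castSucc) + β stretchCubeResp b` and exponential decay bounds imply, for
every bond `b`, `cohFlux b = γ ∫₀^∞ m_N² + absorbedWork b` (`rightBalance_of_duhamel` read through the route
vocabulary `cohFlux`, `absorbedWork` of `Theorems/PhononMeanFreePathDefs`). [folklore] -/
theorem stub_rightBalance_of_meanField :
    ∀ ω₂ lam β γ : ℝ, 0 < ω₂ → 0 < lam → 0 < β → 0 < γ → ∀ T : ℝ, 0 < T → ∀ N : ℕ,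
      ((∀ (x : Fin (N + 1)) (t : ℝ), 0 ≤ t →
          posResp ω₂ lam β γ T N x t = ∫ s in (0 : ℝ)..t, momResp ω₂ lam β γ T N x s) ∧
        (∀ (x : Fin (N + 1)) (t : ℝ), 0 ≤ t →
          momResp ω₂ lam β γ T N x t = (if (x : ℕ) = 0 then T else 0) +
            ∫ s in (0 : ℝ)..t, (-(ω₂ * posResp ω₂ lam β γ T N x s) - lam * cubeResp ω₂ lam β γ T N x s +
              (∑ b : Fin N, ((if (b : ℕ) = (x : ℕ) then bondForceResp ω₂ lam β γ T N b s else 0) -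
                (if (b : ℕ) + 1 = (x : ℕ) then bondForceResp ω₂ lam β γ T N b s else 0))) -
              γ * ((if (x : ℕ) = 0 then 1 else 0) + (if (x : ℕ) = N then 1 else 0)) *
                momResp ω₂ lam β γ T N x s))) →
      ((∀ x : Fin (N + 1), Continuous (momResp ω₂ lam β γ T N x) ∧ Continuous (posResp ω₂ lam β γ T N x) ∧
          Continuous (cubeResp ω₂ lam β γ T N x)) ∧
        (∀ b : Fin N, Continuous (stretchCubeResp ω₂ lam β γ T N b)) ∧
        (∀ (b : Fin N) (t : ℝ), bondForceResp ω₂ lam β γ T N b t =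
          posResp ω₂ lam β γ T N b.succ t - posResp ω₂ lam β γ T N b.castSucc t +
            β * stretchCubeResp ω₂ lam β γ T N b t) ∧
        (∃ C c : ℝ, 0 < c ∧ ∀ t : ℝ, 0 ≤ t →
          (∀ x : Fin (N + 1), |momResp ω₂ lam β γ T N x t| ≤ C * Real.exp (-c * t) ∧
              |posResp ω₂ lam β γ T N x t| ≤ C * Real.exp (-c * t) ∧
              |cubeResp ω₂ lam β γ T N x t| ≤ C * Real.exp (-c * t)) ∧
          (∀ b : Fin N, |stretchCubeResp ω₂ lam β γ T N b t| ≤ C * Real.exp (-c * t)))) →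
      ∀ b : Fin N, cohFlux ω₂ lam β γ T N b =
        γ * (∫ t in Ioi (0 : ℝ), momResp ω₂ lam β γ T N (Fin.last N) t ^ 2) + absorbedWork ω₂ lam β γ T N b := by
  intro ω₂ lam β γ _ _ _ _ T _ N hD hR b
  obtain ⟨hn, hm⟩ := hD
  obtain ⟨hcont, hdc, hF, C, r, hr, hdec⟩ := hR
  unfold cohFlux absorbedWork
  exact rightBalance_of_duhamel hn hm (fun x => (hcont x).1) (fun x => (hcont x).2.1) (fun x => (hcont x).2.2)
    hdc hF hr (fun x t ht => ((hdec t ht).1 x).1) (fun x t ht => ((hdec t ht).1 x).2.1)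
    (fun x t ht => ((hdec t ht).1 x).2.2) (fun b' t ht => (hdec t ht).2 b') b

end Summit.AtomisticToContinuum.FouriersLaw.Theorems.CoherentDephasing.RightBalance

end
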